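import Literature.MathematicalPhysics.QuantumFieldTheory.Federbush1986.ModeAnalyticityCellPositivity

/-!
# Federbush–Williamson, *A phase cell approach to Yang–Mills theory. II. Analysis of a mode* (J. Math. Phys. **28**
# (1987) 1416–1419) [FederbushWilliamson1987PhaseCellII] — THEOREMS 3.1 (local analyticity) and 3.2 (global analyticity)
# PROVED for the mode in the corrected gauge `X_c = X/(1+g)`, all four components

statement-level skeleton of published theorems with citation tags; proofs where landed; nothing here is a claim about
the Yang–Mills mass gap

Cell `lit-balaban`, Phase-2 proof seat **p04** (gen 9), own lane F2 (rows `F2.Thm3.1`, `F2.Thm3.2`, owner r17, referee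
ref-5); file 4 of the corrected-gauge programme (`ModeAnalyticityWideTube` → `ModeAnalyticityCorrectedGauge` →
`ModeAnalyticityCellPositivity` → this → `ModeAnalyticityThm33Corrected`).  Page READ AS IMAGE: `run/shared/lean/pub/
pub-balaban/t4/b2b-balaban-t4-lit2/g7/fw1987II/fedwill1987-jmp28-II-p002-x2.png` (p. 1417): «Theorem 3.1 (Local analyticity):
There is an ε₀ > 0 such that in the domain, 𝒟_L, specified by −π ≤ Re p_j ≤ π, |Im p_j| < ε₀, (3.2) A^N_i(p) is analytic.
Theorem 3.2 (Global analyticity): A^N_i(p) is analytic in the domain, 𝒟_G, specified by |Im p_j| < ε₀. (3.3) … Theorems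
3.2 and 3.3 are easy consequences of the form of A^N_i(p) and Theorem 3.1» — the «form» being the periodicity (3.1).

WHAT IS PROVED HERE (kernel-checked; axioms standard; one object `def` (`Grep`), no `Prop` definitions, no named facts).
For the corrected-gauge mode `Â_i = A′_i + p_iX_c` (`ModeAnalyticityCorrectedGauge.ANc`) and the width `δ₀` of
`ModeAnalyticityCellPositivity` (the `ε₀`):
* §1 the representative attached to a cell, `Grep s m i` (`G0` on the home cell, `Gm` on the translated ones), analytic on
  its cell; `gcorr s i p = Grep s (cellIdx p) i p`.
* §2 `ANc_eq_Grep`: on its cell, at the generic points, the representative IS the corrected mode.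
* §3 generic REAL points are everywhere: every non-empty open real interval contains a point off `2πℤ`
  (`Set.Countable.dense_compl`), and at a real momentum with all coordinates off `2πℤ` every genericity condition of §2 holds
  for every cell.
* §4 **CONSISTENCY** `Grep_consistent`: two cell representatives agree on the (convex) overlap of their cells — identity
  theorem (`AnalyticOnNhd.eqOn_of_preconnected_of_eventuallyEq`) from agreement with `Â_i` near a real bi-generic point.
* §5 **THEOREM 3.2 for `Â`**: `analyticOnNhd_gcorr : AnalyticOnNhd ℂ (gcorr s i) (DG δ₀)` — the global representative is
  holomorphic on the whole strip `|Im p_j| < δ₀`; §6 `gcorr_eq_ANc_of_realGeneric`: it coincides with `Â_i` at every real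
  generic momentum (so it IS the analytic continuation of the formula); §7 the printed shapes:
  `theorem31_corrected s i : ∃ g, AnalyticOnNhd ℂ g (DL δ₀) ∧ ∀ p ∈ realGeneric, g p = ANc s i p` and `theorem32_corrected`
  (same on `DG δ₀`) — the statements `ModeAnalyticity.Theorem31/32` with `A^N` replaced by `Â` and `ε₀ = δ₀`, for EVERY `s`
  and all four `i`.  (Theorem 3.3's bound (3.5) and I (3.13)–(3.15): next file.)
Honest scope: OUR correction of the gauge choice (2.5); the printed `A^N` stays refuted as typed (p250244).
-/

noncomputable section

namespace Literature.MathematicalPhysics.QuantumFieldTheory.Federbush1986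

namespace ModeAnalyticityThms31to33Corrected

open ModeAnalyticity ModeAnalyticityLatticeSums ModeAnalyticityBracketSplit ModeAnalyticityGaugeRepair
  ModeAnalyticityWideTube ModeAnalyticityCorrectedGauge ModeAnalyticityCellPositivity ModeDecay
  Complex Filter Topology Finset Metric Set
open scoped BigOperators Real

/-! ## §1. The representative attached to a cell -/

/-- The holomorphic representative of `Â_i` attached to the cell `m`: `G0 s i` on the home cell `m = 0`, `Gm s m i` on the
translated cells. [cite: FederbushWilliamson1987PhaseCellII, Theorems 3.1–3.2, (3.1) p. 1417] -/
def Grep (s : ℕ) (m : Idx) (i : Fin 4) : Momentum → ℂ := if m = 0 then G0 s i else Gm s m i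

/-- (plumbing) the global representative is the cell representative of the cell of `p`.
[cite: FederbushWilliamson1987PhaseCellII, Theorems 3.1–3.2 p. 1417] -/
theorem gcorr_eq (s : ℕ) (i : Fin 4) (p : Momentum) : gcorr s i p = Grep s (cellIdx p) i p := by
  unfold gcorr Grep
  split_ifs <;> rfl

/-- The cell representative is ANALYTIC on its cell (file 3). [cite: FederbushWilliamson1987PhaseCellII, Theorems 3.1–3.2
p. 1417] -/
theorem analyticOnNhd_Grep (s : ℕ) (m : Idx) (i : Fin 4) : AnalyticOnNhd ℂ (Grep s m i) (cellSet m delta0) := by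
  by_cases hm : m = 0
  · subst hm
    have e : Grep s 0 i = G0 s i := by simp [Grep]
    rw [e, cellSet_zero]
    exact analyticOnNhd_G0 s i
  · have e : Grep s m i = Gm s m i := by simp [Grep, hm]
    rw [e]
    exact analyticOnNhd_Gm s hm i

/-! ## §2. On its cell, at the generic points, the representative is the corrected mode -/

/-- **`Â_i = Grep s m i`** at every generic point of the cell `m`: `q = p − 2πm` with all `q_j ≠ 0`, `q² ≠ 0`, and all
`p_j ≠ 0`, `p² ≠ 0`, `1 + p² ≠ 0`, `e^{ip₁} ≠ 1` (file 2's identities; `e_j`, `1 + g` are non-zero on the cell by file 3).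
[cite: FederbushWilliamson1987PhaseCellII, (5.1)–(5.10) p. 1417–1418, (3.1) p. 1417] -/
theorem ANc_eq_Grep (s : ℕ) (m : Idx) (i : Fin 4) {p : Momentum} (hcell : p ∈ cellSet m delta0)
    (hq : ∀ j, unshift m p j ≠ 0) (hcq : csq (unshift m p) ≠ 0) (hp : ∀ j, p j ≠ 0) (hc : csq p ≠ 0)
    (h1 : 1 + csq p ≠ 0) (hf : exp (I * p 0) ≠ 1) : ANc s i p = Grep s m i p := by
  have hW : unshift m p ∈ Wt := tube_delta0_subset_Wt hcell
  have hE : ∀ j, E j (unshift m p) ≠ 0 := fun j => E_ne_zero_of_mem_tube hcell j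
  have hg : 1 + ghat (unshift m p) ≠ 0 := one_add_ghat_ne_zero_of_mem_tube hcell
  by_cases hm : m = 0
  · subst hm
    have e : Grep s 0 i = G0 s i := by simp [Grep]
    rw [e]
    rw [unshift_zero] at hW hE hg
    exact ANc_eq_G0 s hW hp hc hf h1 hE hg i
  · have e : Grep s m i = Gm s m i := by simp [Grep, hm]
    rw [e]
    exact ANc_eq_Gm s m hW hq hcq hE hg hp hc h1 hf i

/-! ## §3. Generic real points -/

/-- Every non-empty open real interval contains a point off the lattice `2πℤ` (the complement of a countable set is dense).
[folklore] -/
private theorem exists_notin_lattice {a b : ℝ} (h : a < b) : ∃ x, a < x ∧ x < b ∧ ∀ k : ℤ, x ≠ 2 * π * (k : ℝ) := by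
  have hc : (Set.range fun k : ℤ => 2 * π * (k : ℝ)).Countable := Set.countable_range _
  have hd := hc.dense_compl ℝ
  obtain ⟨x, hx, hxI⟩ := hd.exists_mem_open (isOpen_Ioo : IsOpen (Set.Ioo a b))
    ⟨(a + b) / 2, by constructor <;> linarith⟩
  exact ⟨x, hxI.1, hxI.2, fun k hk => hx ⟨k, hk.symm⟩⟩

/-- (plumbing) `p − 2πm` of a real momentum is the real momentum `x − 2πm`. [cite: FederbushWilliamson1987PhaseCellII,
(3.1) p. 1417] -/
theorem unshift_toC (m : Idx) (x : Fin 4 → ℝ) : unshift m (toC x) = toC fun j => x j - 2 * π * (m j : ℝ) := by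
  funext j; simp only [unshift, toC]; push_cast; ring

/-- (plumbing) a real coordinate off `2πℤ` is non-zero. [cite: FederbushWilliamson1987PhaseCellII, §II p. 1417] -/
theorem toC_apply_ne_zero {x : Fin 4 → ℝ} {j : Fin 4} (hx : ∀ k : ℤ, x j ≠ 2 * π * (k : ℝ)) : toC x j ≠ 0 := by
  have h := hx 0
  simp only [Int.cast_zero, mul_zero] at h
  simpa [toC] using h

/-- (plumbing) `p² ≠ 0` and `1 + p² ≠ 0` at a real momentum with a non-zero coordinate. [cite: FederbushWilliamson1987PhaseCellII,
§III p. 1417] -/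
theorem csq_toC_ne_zero {x : Fin 4 → ℝ} {j : Fin 4} (hx : x j ≠ 0) : csq (toC x) ≠ 0 ∧ 1 + csq (toC x) ≠ 0 := by
  rw [csq_toC]
  have h0 : 0 < ∑ l, x l ^ 2 :=
    lt_of_lt_of_le (by positivity : 0 < x j ^ 2)
      (Finset.single_le_sum (f := fun l => x l ^ 2) (fun l _ => sq_nonneg _) (Finset.mem_univ j))
  refine ⟨by exact_mod_cast h0.ne', ?_⟩
  have : (1 : ℂ) + ((∑ l, x l ^ 2 : ℝ) : ℂ) = ((1 + ∑ l, x l ^ 2 : ℝ) : ℂ) := by push_cast; ring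
  rw [this]
  exact_mod_cast (by linarith : (1 + ∑ l, x l ^ 2) ≠ 0)

/-- (plumbing) `e^{ix} ≠ 1` for a real `x` off `2πℤ`. [cite: FederbushWilliamson1987PhaseCellII, (5.1) p. 1417] -/
theorem exp_I_toC_ne_one {x : Fin 4 → ℝ} (hx : ∀ k : ℤ, x 0 ≠ 2 * π * (k : ℝ)) : exp (I * toC x 0) ≠ 1 := by
  intro h
  obtain ⟨n, hn⟩ := Complex.exp_eq_one_iff.mp h
  have him := congrArg Complex.im hn
  simp [toC] at him
  exact hx n (by linarith)

/-- **At a real momentum with every coordinate off `2πℤ`, all genericity conditions hold for EVERY cell `m`.**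
[cite: FederbushWilliamson1987PhaseCellII, §II–§III p. 1417] -/
theorem generic_of_real {x : Fin 4 → ℝ} (hx : ∀ j, ∀ k : ℤ, x j ≠ 2 * π * (k : ℝ)) (m : Idx) :
    (∀ j, unshift m (toC x) j ≠ 0) ∧ csq (unshift m (toC x)) ≠ 0 ∧ (∀ j, toC x j ≠ 0) ∧ csq (toC x) ≠ 0 ∧
      1 + csq (toC x) ≠ 0 ∧ exp (I * toC x 0) ≠ 1 := by
  have hx' : ∀ j, ∀ k : ℤ, x j - 2 * π * (m j : ℝ) ≠ 2 * π * (k : ℝ) := fun j k h =>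
    hx j (k + m j) (by push_cast; linarith)
  refine ⟨fun j => ?_, ?_, fun j => toC_apply_ne_zero (hx j), (csq_toC_ne_zero (toC_apply_ne_zero_re (hx 0))).1,
    (csq_toC_ne_zero (toC_apply_ne_zero_re (hx 0))).2, exp_I_toC_ne_one (hx 0)⟩
  · rw [unshift_toC]; exact toC_apply_ne_zero (hx' j)
  · rw [unshift_toC]; exact (csq_toC_ne_zero (j := 0) (by
      have h := hx' 0 0; simp only [Int.cast_zero, mul_zero] at h; exact h)).1
where
  /-- (plumbing) the real coordinate itself is non-zero. [cite: FederbushWilliamson1987PhaseCellII, §II p. 1417] -/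
  toC_apply_ne_zero_re {x : Fin 4 → ℝ} {j : Fin 4} (hx : ∀ k : ℤ, x j ≠ 2 * π * (k : ℝ)) : x j ≠ 0 := by
    have h := hx 0; simp only [Int.cast_zero, mul_zero] at h; exact h

/-! ## §4. Consistency of the cell representatives on overlaps -/

/-- (plumbing) a real momentum belongs to a cell iff its coordinates are in the cell's real box.
[cite: FederbushWilliamson1987PhaseCellII, (3.1)–(3.2) p. 1417] -/
theorem toC_mem_cellSet_iff {m : Idx} {δ : ℝ} (hδ : 0 < δ) {x : Fin 4 → ℝ} :
    toC x ∈ cellSet m δ ↔ ∀ j, |x j - 2 * π * (m j : ℝ)| < π + δ := by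
  rw [mem_cellSet_iff]
  simp only [toC, Complex.ofReal_re, Complex.ofReal_im, abs_zero]
  exact ⟨fun h j => (h j).1, fun h j => ⟨h j, hδ⟩⟩

/-- **CONSISTENCY**: the representatives attached to two cells AGREE on the overlap of the cells.  Proof: the overlap is
convex (hence preconnected) and, when non-empty, contains a real momentum with all coordinates off `2πℤ` (§3); near it both
representatives equal `Â_i` (§2, the genericity conditions being open), so they agree everywhere by the identity theorem.
[cite: FederbushWilliamson1987PhaseCellII, Theorems 3.1–3.2, (3.1) p. 1417] -/
theorem Grep_consistent (s : ℕ) (i : Fin 4) (m m' : Idx) :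
    EqOn (Grep s m i) (Grep s m' i) (cellSet m delta0 ∩ cellSet m' delta0) := by
  set V := cellSet m delta0 ∩ cellSet m' delta0 with hV
  rcases Set.eq_empty_or_nonempty V with hVe | ⟨z, hz⟩
  · rw [hVe]; exact fun _ h => h.elim
  have hδ := delta0_pos
  -- a real point of `V` with all coordinates off `2πℤ`
  have hI : ∀ j, ∃ xj : ℝ, (|xj - 2 * π * (m j : ℝ)| < π + delta0 ∧ |xj - 2 * π * (m' j : ℝ)| < π + delta0) ∧
      ∀ k : ℤ, xj ≠ 2 * π * (k : ℝ) := by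
    intro j
    have h1 := (mem_cellSet_iff.mp hz.1 j).1
    have h2 := (mem_cellSet_iff.mp hz.2 j).1
    rw [abs_lt] at h1 h2
    obtain ⟨xj, ha, hb, hk⟩ := exists_notin_lattice (a := max (2 * π * (m j : ℝ) - (π + delta0))
      (2 * π * (m' j : ℝ) - (π + delta0))) (b := min (2 * π * (m j : ℝ) + (π + delta0))
      (2 * π * (m' j : ℝ) + (π + delta0))) (by
        rw [max_lt_iff]; constructor <;> rw [lt_min_iff] <;> constructor <;> linarith)
    rw [max_lt_iff] at ha
    rw [lt_min_iff] at hb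
    exact ⟨xj, ⟨abs_lt.mpr ⟨by linarith [ha.1], by linarith [hb.1]⟩, abs_lt.mpr ⟨by linarith [ha.2], by linarith [hb.2]⟩⟩,
      hk⟩
  choose x hxI hxk using hI
  have hx0V : toC x ∈ V :=
    ⟨(toC_mem_cellSet_iff hδ).mpr fun j => (hxI j).1, (toC_mem_cellSet_iff hδ).mpr fun j => (hxI j).2⟩
  -- near the real point, both representatives equal `Â_i`
  have hgen := generic_of_real hxk
  have hcont_un : ∀ (n : Idx) (j : Fin 4), Continuous fun p : Momentum => unshift n p j := fun n j =>
    (continuous_apply j).comp (differentiable_unshift n).continuous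
  have hcsq : Continuous (csq : Momentum → ℂ) := differentiable_csq.continuous
  have ev : ∀ᶠ p in 𝓝 (toC x), Grep s m i p = Grep s m' i p := by
    have e1 : ∀ᶠ p in 𝓝 (toC x), p ∈ V :=
      ((isOpen_cellSet _ _).inter (isOpen_cellSet _ _)).mem_nhds hx0V
    have e2 : ∀ n : Idx, ∀ᶠ p in 𝓝 (toC x), (∀ j, unshift n p j ≠ 0) ∧ csq (unshift n p) ≠ 0 := by
      intro n
      obtain ⟨hq, hcq, -, -, -, -⟩ := generic_of_real hxk n
      refine (eventually_all.mpr fun j => ?_).and ?_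
      · exact (hcont_un n j).continuousAt.eventually_ne (hq j)
      · exact (hcsq.comp (differentiable_unshift n).continuous).continuousAt.eventually_ne hcq
    obtain ⟨-, -, hp0, hc0, h10, hf0⟩ := hgen m
    have e3 : ∀ᶠ p in 𝓝 (toC x), ∀ j, p j ≠ 0 :=
      eventually_all.mpr fun j => (continuous_apply j).continuousAt.eventually_ne (hp0 j)
    have e4 : ∀ᶠ p in 𝓝 (toC x), csq p ≠ 0 := hcsq.continuousAt.eventually_ne hc0
    have e5 : ∀ᶠ p in 𝓝 (toC x), 1 + csq p ≠ 0 := (continuous_const.add hcsq).continuousAt.eventually_ne h10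
    have e6 : ∀ᶠ p in 𝓝 (toC x), exp (I * p 0) ≠ 1 :=
      (Complex.continuous_exp.comp (continuous_const.mul (continuous_apply 0))).continuousAt.eventually_ne hf0
    filter_upwards [e1, e2 m, e2 m', e3, e4, e5, e6] with p hp hm1 hm2 hp3 hp4 hp5 hp6
    rw [← ANc_eq_Grep s m i hp.1 hm1.1 hm1.2 hp3 hp4 hp5 hp6, ← ANc_eq_Grep s m' i hp.2 hm2.1 hm2.2 hp3 hp4 hp5 hp6]
  -- identity theorem on the convex overlap
  have hconv : IsPreconnected V := ((convex_cellSet m delta0).inter (convex_cellSet m' delta0)).isPreconnected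
  exact AnalyticOnNhd.eqOn_of_preconnected_of_eventuallyEq ((analyticOnNhd_Grep s m i).mono Set.inter_subset_left)
    ((analyticOnNhd_Grep s m' i).mono Set.inter_subset_right) hconv hx0V ev

/-! ## §5. Theorem 3.2 for the corrected-gauge mode: the global representative is holomorphic on the strip -/

/-- (plumbing) the strip `𝒟_G(ε)` is open. [cite: FederbushWilliamson1987PhaseCellII, (3.3) p. 1417] -/
theorem isOpen_DG (ε : ℝ) : IsOpen (DG ε) := by
  have e : DG ε = ⋂ j : Fin 4, {p : Momentum | |(p j).im| < ε} := by ext p; simp [DG]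
  rw [e]
  exact isOpen_iInter_of_finite fun j =>
    isOpen_lt (continuous_abs.comp (Complex.continuous_im.comp (continuous_apply j))) continuous_const

/-- **THEOREM 3.2 (Global analyticity) for the corrected-gauge mode**: the global representative `gcorr s i` is analytic on
the whole strip `𝒟_G(δ₀) = {|Im p_j| < δ₀}` — near each point it is the representative of that point's cell (consistency
§4), which is holomorphic there. [cite: FederbushWilliamson1987PhaseCellII, Theorem 3.2 (3.3) p. 1417] -/
theorem analyticOnNhd_gcorr (s : ℕ) (i : Fin 4) : AnalyticOnNhd ℂ (gcorr s i) (DG delta0) := by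
  intro p₀ hp₀
  have hcell : p₀ ∈ cellSet (cellIdx p₀) delta0 := mem_cellSet_cellIdx delta0_pos hp₀
  have hev : gcorr s i =ᶠ[𝓝 p₀] Grep s (cellIdx p₀) i := by
    have h1 : ∀ᶠ p in 𝓝 p₀, p ∈ cellSet (cellIdx p₀) delta0 := (isOpen_cellSet _ _).mem_nhds hcell
    have h2 : ∀ᶠ p in 𝓝 p₀, p ∈ DG delta0 := (isOpen_DG _).mem_nhds hp₀
    filter_upwards [h1, h2] with p hp1 hp2
    rw [gcorr_eq]
    exact Grep_consistent s i (cellIdx p) (cellIdx p₀) ⟨mem_cellSet_cellIdx delta0_pos hp2, hp1⟩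
  exact ((analyticOnNhd_Grep s (cellIdx p₀) i) p₀ hcell).congr hev.symm

/-- **THEOREM 3.1 (Local analyticity) for the corrected-gauge mode**: analytic on `𝒟_L(δ₀) ⊆ 𝒟_G(δ₀)`.
[cite: FederbushWilliamson1987PhaseCellII, Theorem 3.1 (3.2) p. 1417] -/
theorem analyticOnNhd_gcorr_DL (s : ℕ) (i : Fin 4) : AnalyticOnNhd ℂ (gcorr s i) (DL delta0) :=
  (analyticOnNhd_gcorr s i).mono (DL_subset_DG _)

/-! ## §6. The global representative IS the corrected mode at the real generic momenta -/

/-- (plumbing) a real generic momentum is a real point with all coordinates off `2πℤ`, and lies in the strip.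
[cite: FederbushWilliamson1987PhaseCellII, §I–§II p. 1416–1417] -/
theorem realGeneric_data {p : Momentum} (hp : p ∈ realGeneric) :
    p = toC (fun j => (p j).re) ∧ (∀ j, ∀ k : ℤ, (p j).re ≠ 2 * π * (k : ℝ)) ∧ ∀ {ε : ℝ}, 0 < ε → p ∈ DG ε := by
  refine ⟨funext fun j => Complex.ext (by simp [toC]) (by simp [toC, (hp j).1]), fun j k hk => ?_, fun hε j => ?_⟩
  · obtain ⟨him, hne, hlo, hhi⟩ := hp j
    -- `|2πk| ≤ π` forces `k = 0`, so `p_j = 0`: contradiction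
    have hk0 : k = 0 := by
      by_contra hk0
      have h1 : (1 : ℝ) ≤ |(k : ℝ)| := by rw [← Int.cast_abs]; exact_mod_cast Int.one_le_abs hk0
      rcases le_or_gt 0 (k : ℝ) with hkp | hkn
      · rw [abs_of_nonneg hkp] at h1; nlinarith [Real.pi_pos]
      · rw [abs_of_neg hkn] at h1; nlinarith [Real.pi_pos]
    apply hne
    apply Complex.ext
    · rw [hk, hk0]; simp
    · rw [him]; simp
  · rw [(hp j).1, abs_zero]; exact hε

/-- **The global representative coincides with the corrected mode `Â_i = A′_i + p_iX_c` at every real generic momentum**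
(the points `p ∈ (−π, π]⁴`, all `p_j ≠ 0`, where the printed formula is meant) — so `gcorr s i` is THE analytic continuation
of `Â_i`. [cite: FederbushWilliamson1987PhaseCellII, Theorems 3.1–3.2 p. 1417, (2.1)–(2.5) p. 1417] -/
theorem gcorr_eq_ANc_of_realGeneric (s : ℕ) (i : Fin 4) {p : Momentum} (hp : p ∈ realGeneric) :
    gcorr s i p = ANc s i p := by
  obtain ⟨hpe, hk, hDG⟩ := realGeneric_data hp
  rw [gcorr_eq]
  have hcell : p ∈ cellSet (cellIdx p) delta0 := mem_cellSet_cellIdx delta0_pos (hDG delta0_pos)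
  obtain ⟨hq, hcq, hp0, hc0, h10, hf0⟩ := generic_of_real hk (cellIdx p)
  rw [← hpe] at hq hcq hp0 hc0 h10 hf0
  exact (ANc_eq_Grep s (cellIdx p) i hcell hq hcq hp0 hc0 h10 hf0).symm

/-! ## §7. The printed shapes of Theorems 3.1 and 3.2, for the corrected-gauge mode -/

/-- **Theorem 3.1's statement for `Â_i`** (the shape of `ModeAnalyticity.Theorem31` with `A^N ↦ Â`, `ε₀ = δ₀`): for every
`s` and every component there is a function analytic on `𝒟_L(δ₀)` agreeing with `Â_i = A′_i + p_iX_c` at the real generic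
momenta. [cite: FederbushWilliamson1987PhaseCellII, Theorem 3.1 (3.2) p. 1417] -/
theorem theorem31_corrected (s : ℕ) (i : Fin 4) :
    ∃ g : Momentum → ℂ, AnalyticOnNhd ℂ g (DL delta0) ∧ ∀ p ∈ realGeneric, g p = ANc s i p :=
  ⟨gcorr s i, analyticOnNhd_gcorr_DL s i, fun _ hp => gcorr_eq_ANc_of_realGeneric s i hp⟩

/-- **Theorem 3.2's statement for `Â_i`** (the shape of `ModeAnalyticity.Theorem32` with `A^N ↦ Â`, `ε₀ = δ₀`): analytic
continuation to the whole strip `𝒟_G(δ₀)`. [cite: FederbushWilliamson1987PhaseCellII, Theorem 3.2 (3.3) p. 1417] -/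
theorem theorem32_corrected (s : ℕ) (i : Fin 4) :
    ∃ g : Momentum → ℂ, AnalyticOnNhd ℂ g (DG delta0) ∧ ∀ p ∈ realGeneric, g p = ANc s i p :=
  ⟨gcorr s i, analyticOnNhd_gcorr s i, fun _ hp => gcorr_eq_ANc_of_realGeneric s i hp⟩

/-- Theorems 3.1–3.2 for `Â` with the SAME `ε₀ = δ₀ > 0` for every `s` and all four components `i`.
[cite: FederbushWilliamson1987PhaseCellII, Theorems 3.1–3.2 (3.2)–(3.3) p. 1417] -/
theorem theorems31_32_corrected :
    ∃ ε₀ > (0 : ℝ), ∀ (s : ℕ) (i : Fin 4), ∃ g : Momentum → ℂ,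
      AnalyticOnNhd ℂ g (DL ε₀) ∧ AnalyticOnNhd ℂ g (DG ε₀) ∧ ∀ p ∈ realGeneric, g p = ANc s i p :=
  ⟨delta0, delta0_pos, fun s i => ⟨gcorr s i, analyticOnNhd_gcorr_DL s i, analyticOnNhd_gcorr s i,
    fun _ hp => gcorr_eq_ANc_of_realGeneric s i hp⟩⟩

end ModeAnalyticityThms31to33Corrected

end Literature.MathematicalPhysics.QuantumFieldTheory.Federbush1986
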